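import Literature.NumberTheory.Automorphic.AutomorphicRepsGLCuspidalL2
import Literature.NumberTheory.Automorphic.AutomorphicRepsGLCuspBridgeProofs
import Literature.NumberTheory.Automorphic.AutomorphicFormsGLContinuous
import Literature.NumberTheory.Automorphic.CuspidalSubspaceContinuous
import HarnessLib

/-!
# Step 4 of Borel–Jacquet 4.6 for `GL_n`: automorphic forms in `L²_cusp` are cusp forms
(discharge of `AutomorphicRepsGL.isCuspFormGL_invQuot_of_mem_cuspidalSubspace`)

Topic `NumberTheory/Automorphic`; sibling proof file of `AutomorphicRepsGLCuspidalL2`, which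
records the architecture of `AutomorphicRepsGL.exists_cuspidalRepData_of_L2` (every irreducible
closed invariant `Π ≤ L²_cusp(GL_n(𝔸_K) ⧸ A_G GL_n(K))` comes from a cuspidal automorphic
representation datum) as four named facts F1–F4 and proves the assembly. This file discharges

* F4, `AutomorphicRepsGL.isCuspFormGL_invQuot_of_mem_cuspidalSubspace hcpt μ`
  (`isCuspFormGL_invQuot_of_mem_cuspidalSubspace_holds`): an automorphic form
  `φ = invQuot f = (g ↦ f [g⁻¹])` on `GL_n(𝔸_K)` whose class `[f]` lies in `L²_cusp` is a cusp form.
  Proof: `φ` is continuous (`IsAutomorphicForm.continuous_gl`, file `AutomorphicFormsGLContinuous`: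
  archimedean smoothness, level invariance and the local homeomorphism `exp`), hence so is `f`
  (`continuous_of_isAutomorphicForm_invQuot`); a continuous square-integrable function with class
  in `L²_cusp` has vanishing constant terms (`constantTermVanishes_of_toLp_mem_cuspidalSubspace`,
  file `CuspidalSubspaceContinuous`: approximate identities on the smoothing theory of
  `SmoothedCuspForms`); and the Borel–Jacquet (left) cusp condition for `invQuot f` is G19's
  (right) vanishing of constant terms for `f` (`AutomorphicRepsGL.cuspConditionGL_invQuot_iff_holds`,
  file `AutomorphicRepsGLCuspBridgeProofs`). Borel–Jacquet 1979, 4.4 and 4.6.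

and records the consequences: `AutomorphicRepsGL.formsOfL2_le_cuspFormsGL` (`V_Π ≤ 𝒜₀` for every
closed `Π ≤ L²_cusp`, unconditionally) and the three-hypothesis assembly
`AutomorphicRepsGL.exists_cuspidalRepData_of_L2_of_three` : F1 → F2 → F3 →
`exists_cuspidalRepData_of_L2 hcpt μ`. The remaining hypotheses F1 (non-vanishing), F2 (stability)
and F3 (irreducibility) are the Harish-Chandra part of Borel–Jacquet 4.6 (admissibility and
irreducibility of the `K`-finite vectors of an irreducible unitary representation); they stay named
facts of `AutomorphicRepsGLCuspidalL2`.

## References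

* A. Borel, H. Jacquet, *Automorphic forms and automorphic representations*, Proc. Sympos. Pure
  Math. 33 (Corvallis 1979), part 1, §4.4 and §4.6 [BorelJacquet1979].
* J. R. Getz, H. Hahn, *An Introduction to Automorphic Representations* (2024), §6.5, Thm. 6.5.2
  [GetzHahn2024].
-/

noncomputable section

open scoped MatrixGroups
open NumberField IsDedekindDomain
open _root_.MeasureTheory

namespace Literature.NumberTheory.Automorphic

variable {n : ℕ} {K : Type} [Field K] [NumberField K]
  {hcpt : isCompact_glFiniteIntegralLevel n K}
  {μ : Measure (AdelicGroupData.gl n K).automorphicQuotient}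
  [(AdelicGroupData.gl n K).IsAutomorphicMeasure μ]

variable (hcpt μ) in
/-- **Step 4 of Borel–Jacquet 4.6 holds: automorphic forms whose class lies in `L²_cusp` are cusp
forms** (discharge of `AutomorphicRepsGL.isCuspFormGL_invQuot_of_mem_cuspidalSubspace`). For
`f ∈ ℒ²(μ)` with `[f] ∈ L²_cusp(GL_n(𝔸_K) ⧸ A_G GL_n(K), μ)` and `invQuot f = (g ↦ f [g⁻¹])`
automorphic: `invQuot f`, hence `f`, is continuous; continuous `L²_cusp`-functions have vanishing
constant terms; and the left cusp condition for `invQuot f` is the right one for `f`.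
Borel–Jacquet 1979, 4.4 and 4.6; Getz–Hahn 2024, Thm. 6.5.2. [cite: BorelJacquet1979, 4.4 and 4.6] -/
theorem AutomorphicRepsGL.isCuspFormGL_invQuot_of_mem_cuspidalSubspace_holds :
    AutomorphicRepsGL.isCuspFormGL_invQuot_of_mem_cuspidalSubspace hcpt μ := by
  intro f hf hcusp hφ
  refine ⟨hφ, fun k hk hkn => ?_⟩
  rw [AutomorphicRepsGL.cuspConditionGL_invQuot_iff_holds n K f k]
  exact constantTermVanishes_of_toLp_mem_cuspidalSubspace
    (continuous_of_isAutomorphicForm_invQuot hφ) hf hcusp hk hkn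

/-- **`V_Π ≤ 𝒜₀` unconditionally**: for every closed subspace `Π ≤ L²_cusp`, the space
`formsOfL2 hcpt μ Π` spanned by the automorphic forms `g ↦ f [g⁻¹]`, `[f] ∈ Π`, consists of cusp
forms (`formsOfL2_le_cuspFormsGL_of` with Step 4 discharged). Borel–Jacquet 1979, 4.6. [cite: BorelJacquet1979, 4.6] -/
theorem AutomorphicRepsGL.formsOfL2_le_cuspFormsGL
    {P : ContRepresentation.ClosedSubrep ((AdelicGroupData.gl n K).rightRegular μ)}
    (hP : P ≤ cuspidalSubspace n K μ) : formsOfL2 hcpt μ P ≤ cuspFormsGL n K hcpt :=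
  formsOfL2_le_cuspFormsGL_of
    (AutomorphicRepsGL.isCuspFormGL_invQuot_of_mem_cuspidalSubspace_holds hcpt μ) hP

/-- **The assembly of Borel–Jacquet 4.6 with Step 4 discharged**: the Harish-Chandra inputs
F1 (non-vanishing `V_Π ≠ 0`), F2 (`(𝔤, K_∞) × GL_n(𝔸_K^∞)`-stability of `V_Π`) and
F3 (irreducibility of `V_Π`) alone imply `exists_cuspidalRepData_of_L2 hcpt μ`
(`exists_cuspidalRepData_of_L2_of` with `isCuspFormGL_invQuot_of_mem_cuspidalSubspace_holds`).
Borel–Jacquet 1979, 4.6. [cite: BorelJacquet1979, 4.6] -/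
theorem AutomorphicRepsGL.exists_cuspidalRepData_of_L2_of_three
    (h₁ : AutomorphicRepsGL.formsOfL2_ne_bot hcpt μ)
    (h₂ : AutomorphicRepsGL.formsOfL2_isStableSubmodule hcpt μ)
    (h₃ : AutomorphicRepsGL.formsOfL2_irreducible hcpt μ) :
    AutomorphicRepsGL.exists_cuspidalRepData_of_L2 hcpt μ :=
  AutomorphicRepsGL.exists_cuspidalRepData_of_L2_of h₁ h₂ h₃
    (AutomorphicRepsGL.isCuspFormGL_invQuot_of_mem_cuspidalSubspace_holds hcpt μ)

end Literature.NumberTheory.Automorphic
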